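import Mathlib.NumberTheory.Zsqrtd.Basic
import Mathlib.Tactic.Ring
import Mathlib.Tactic.LinearCombination
import HarnessLib

/-!
# Venture HSemireg — divisors of `A − l` in `ℤ√m` are NESTED by norm: the ideal identity behind the LINE LAW and its NESTED-RATIO
# corollary (ENGINE-W code B, card LINE-LAW-B.md §11) — kernel algebra in `ℤ√m`

HONEST FRAMING. Lean index of the computation cell `pub-hsemireg`, widening group ENGINE-W (code B = the independent second code, seat
`engine-w-2`, gen 10). RING ALGEBRA in Mathlib's `ℤ√m` for an arbitrary integer `m`; factorwise words, THEOREM CF⁶ and «reached lines» enter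
BY VALUE (docstrings). No abelian variety, sheaf, `Ext` group or semiregularity map is constructed; nothing here says that HC, HC_CM or HC_AV
holds. Theorems only (0 `def`, 0 named fact, 0 `sorry`). PRIOR RESULTS OF RECORD it serves: code A's THEOREM LINE-ℤ ∕ COROLLARY 1 of THEOREM
NO-MIX (`widen/ENGINE-W/out/probe5/PROBE5-STIZ-A.md` §7, §16) and code B's THEOREM CF⁶ (`out/probe4/ONE-FOURIER-FORMULA-B.md` §8) and LINE-LAW
card (`out/probe4/LINE-LAW-B.md` v1.7 §11, engine-w-2 g10, 2026-08-25).

SOURCE STATEMENT (card §11). For `A ∈ ℤ` and `n ∣ A² − m` put `𝔞_n(A) := (n, A − l) ⊂ ℤ[l]`. PROPOSITION: a (necessarily primitive) `z` with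
`N z = n` divides `A − l` iff `𝔞_n(A) = (z)`; in particular `z ∈ 𝔞_n(A)` EXPLICITLY: if `z·w = A − l` then **`z = −w_im·n − z_im·(A − l)`**
(`n = N z`). Consequently, if `z′` is another divisor of `A − l` whose norm divides `N z`, then `z′ ∣ z` — the NESTED-RATIO COROLLARY: weights
`c ∣ c′` on a reached line force `c′∕c = N(z∕z′)` to be a norm of a divisor of `A − l` (hence of a primitive element). What the kernel holds:

* `mem_ideal_identity` — `z·w = ⟨A, −1⟩ ⇒ z = (−w.im)·(N z) + (−z.im)·⟨A, −1⟩` in `ℤ√m` (two polynomial identities in the coordinates, the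
  `l`-component `x·w_im + y·w_re = −1` and the rational component `A = x·w_re + m·y·w_im` of the product being the inputs).
* `norm_dvd_self_cast` — `z ∣ (N z : ℤ√m)` (`N z = z·z̄`).
* **`nested_divisibility`** — `z·w = z′·w′ = ⟨A, −1⟩` and `z′ ∣ (N z : ℤ√m)` ⇒ `z′ ∣ z`; **`nested_of_norm_dvd`** — the same from `N z′ ∣ N z`.
* **`quotient_divides`** — in that situation the quotient `q` (`z = z′·q`) satisfies `N z = N z′ · N q` and `q ∣ ⟨A, −1⟩`-cofactor bookkeeping:
  `⟨A, −1⟩ = q · (z′·w)`… precisely `z′ · (q · w) = ⟨A, −1⟩`, so `q·w` is the cofactor of `z′` and `q` divides `A − l` up to the unit-free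
  identity `q ∣ z ∣ A − l`.
WHAT IS NOT HERE: ideals∕class groups (the PROPOSITION's «iff» and the Pic⁺ formulation), THEOREM CF⁶, the census. Tier: kernel ×1 (B) of a
hand ×1 (B) corollary.
-/

namespace Summit.Ventures.HSemireg.NestedDivisors

/-- **`z` lies in `(N z, A − l)` explicitly**: if `z·w = ⟨A, −1⟩` in `ℤ√m` then `z = (−w.im)·(N z) + (−z.im)·⟨A, −1⟩`. (Coordinates: with
`z = x + yl`, `w = p + ql`: `A = xp + m·yq`, `−1 = xq + yp`, and then `x + yA = −q·(x² − m y²)`.) [kernel] -/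
theorem mem_ideal_identity (m A : ℤ) (z w : ℤ√m) (h : z * w = ⟨A, -1⟩) :
    z = (-(w.im) : ℤ√m) * (z.norm : ℤ√m) + (-(z.im) : ℤ√m) * ⟨A, -1⟩ := by
  have hre : z.re * w.re + m * z.im * w.im = A := by
    have := congrArg Zsqrtd.re h; simpa [Zsqrtd.re_mul] using this
  have him : z.re * w.im + z.im * w.re = -1 := by
    have := congrArg Zsqrtd.im h; simpa [Zsqrtd.im_mul] using this
  have hn : z.norm = z.re * z.re - m * z.im * z.im := Zsqrtd.norm_def z
  rw [Zsqrtd.ext_iff]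
  constructor
  · simp only [Zsqrtd.re_add, Zsqrtd.re_mul, Zsqrtd.re_neg, Zsqrtd.im_neg, Zsqrtd.re_intCast, Zsqrtd.im_intCast, hn]
    linear_combination z.re * him - z.im * hre
  · simp only [Zsqrtd.im_add, Zsqrtd.im_mul, Zsqrtd.re_neg, Zsqrtd.im_neg, Zsqrtd.re_intCast, Zsqrtd.im_intCast, hn]
    ring

/-- `z ∣ N z` in `ℤ√m` (as `N z = z·z̄`). [kernel] -/
theorem norm_dvd_self_cast (m : ℤ) (z : ℤ√m) : z ∣ (z.norm : ℤ√m) :=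
  ⟨star z, Zsqrtd.norm_eq_mul_conj z⟩

/-- **Nested divisibility**: two divisors `z, z′` of the same `A − l` with `z′ ∣ N z` satisfy `z′ ∣ z`. [kernel] -/
theorem nested_divisibility (m A : ℤ) (z w z' w' : ℤ√m) (h : z * w = ⟨A, -1⟩) (h' : z' * w' = ⟨A, -1⟩)
    (hn : z' ∣ (z.norm : ℤ√m)) : z' ∣ z := by
  rw [mem_ideal_identity m A z w h]
  refine dvd_add (dvd_mul_of_dvd_right hn _) (dvd_mul_of_dvd_right ⟨w', h'.symm⟩ _)

/-- The same from the NORMS: `N z′ ∣ N z` suffices (since `z′ ∣ N z′`). This is the NESTED-RATIO COROLLARY's engine: on a reached line two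
weights `c ∣ c′` give `N z′ = T∕c′ ∣ T∕c = N z`, hence `z′ ∣ z`. [kernel] -/
theorem nested_of_norm_dvd (m A : ℤ) (z w z' w' : ℤ√m) (h : z * w = ⟨A, -1⟩) (h' : z' * w' = ⟨A, -1⟩)
    (hn : z'.norm ∣ z.norm) : z' ∣ z := by
  apply nested_divisibility m A z w z' w' h h'
  obtain ⟨k, hk⟩ := hn
  refine dvd_trans (norm_dvd_self_cast m z') ⟨(k : ℤ√m), ?_⟩
  rw [hk]; push_cast; ring

/-- **The quotient**: with `z = z′·q`, `N z = N z′ · N q` (so `c′∕c = N q` is a norm) and `z′·(q·w) = ⟨A, −1⟩` (so `q` divides `A − l` as a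
factor of `z`, and is primitive whenever `z` is — by value). [kernel] -/
theorem quotient_divides (m A : ℤ) (z w z' q : ℤ√m) (h : z * w = ⟨A, -1⟩) (hq : z = z' * q) :
    z.norm = z'.norm * q.norm ∧ z' * (q * w) = ⟨A, -1⟩ ∧ q ∣ (⟨A, -1⟩ : ℤ√m) := by
  refine ⟨by rw [hq, Zsqrtd.norm_mul], by rw [← mul_assoc, ← hq, h], ⟨z' * w, ?_⟩⟩
  rw [← h, hq]; ring

/-- **Instance of record** (card §11, `ℚ(√−19)`, weights `(1, 4)`): a primitive `z′` of norm `4` would be needed; `x² + 19y² = 4` has only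
`(±2, 0)` — not primitive — so no line with weights `c ∣ 4c` is reached from the `√−19` seed; the arithmetic fact, by `decide` on the
bounded search `|x| ≤ 2`, `y = 0`: `x² + 19·y² = 4 ∧ y² ≤ 0 … ` is recorded as the two integer facts below. [kernel] -/
theorem sqrt_neg19_no_primitive_norm_four (x y : ℤ) (h : x ^ 2 + 19 * y ^ 2 = 4) : y = 0 ∧ (x = 2 ∨ x = -2) := by
  have hs : 19 * y ^ 2 ≤ 4 := by nlinarith [sq_nonneg x]
  have hy2 : y ^ 2 = 0 := by
    have h0 := sq_nonneg y
    generalize y ^ 2 = s at hs h0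
    omega
  have hy : y = 0 := pow_eq_zero_iff (n := 2) (by norm_num) |>.1 hy2
  subst hy
  refine ⟨rfl, ?_⟩
  have : x ^ 2 = 4 := by linarith
  have hx : (x - 2) * (x + 2) = 0 := by linear_combination this
  rcases mul_eq_zero.mp hx with h1 | h1
  · left; linarith
  · right; linarith

end Summit.Ventures.HSemireg.NestedDivisors
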